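import Summits.QuantumFields.YangMills.Theorems.BalabanUVNodesK0V22ZDefs

/-!
# K0 ∕ N24 lanes — IS THE β OF RECORD AT THE Z3 MEMBER BLIND TO THE (1.2) SMALL-FIELD LETTER `ε₀`?  YES, BY `rfl`: the β-slot χ is the (2.9) species `χ^{(2.9)}_k(ν.εreg, ε₂₉)`,
# which reads the numerics only through the cut-off radius `ν.εreg = a₀`; so stub 3ᴬ′'s ∃-output `ε₀` is a FREE POSITIVE LABEL on K0's side, the window `ε₀ ∈ [2a₀∕L², a₀]` is
# always available, and the strengthened text `…GridGZEps0At` (LOCATED-K0ε₀) is EQUIVALENT to the REGISTERED V22-Z stub 3ᴬ′-G‴-Z text `…GridGZAt`.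

Cell `ym-nodeO-ideate`, DEFINER seat `ym-nodeO-def-1` (gen 29), answering the ONE line plan g92 asked of the NODE O producers (pub-ymgap bus 2026-08-29 13:13Z, FORM CALL (4):
«do the closers at θ₁₃ᶜᶜᴹᵂᶻᴮ(j; γ; εbg := a₀) (CLAIM-1 §2–§3, L3 §3 `clausesH_of_absBoxZB` ∕ §4 sockets) tolerate ε₀ ∈ [2a₀∕L², a₀] — YES ∕ NO») and dag-n24-c g17's open word
«NODE O's ε₀ line» (HOURLY-2, 13:56Z).  `--kind proof --supports stmt-QuantumFields-20541 --as helper`, COUNT-NEUTRAL.  NEW leaf; theorems only — 0 `def`, 0 `sorry`, 0 `instance`,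
0 `notation`.  Imports DEF-1 g28's `K0V22ZDefs` (the two REGISTERED V22-Z texts as tree defs + the letter `K0N09Eps0LetterAt` + the strengthened text + the door strengthened ⟹ registered).
Companion of DEF-1 g27's `K1ZBWitnessBetaRadius` («is β εbg-blind? NO»).  [I] = [Balaban1987RG1]; [B11] = [Balaban1985Variational]; [III] = [Balaban1988Convergent].

THE ANSWER, READ OFF THE TREE'S DEFINITIONS (no estimate; §1 is four `rfl`s).  `betaOfRecord₁₃ F N θ = betaOfRecord₈Tχ F N (TβOfRecord₁₃ F N) (chiFixed29 F N θ.ν θ.ε₂₉) θ.toStage8Params`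
(`Node00/Record13` :180–181, unfolding :184–185), and `betaOfRecord₈Tχ T χ θ₈` reads `θ₈` ONLY through `εbg`, the chart `ρ8`, the basis `bV`, the base histories `v₀` and the window
`γ` (:169–172) — at every member of the numerics families these are `εbg`, `suChartMap N`, `Pi.basisFun`, `0`, `n.γ` (`Node00/Record12NumericsFamilyDict` :107–120, Z-maker
`Record12NumericsFamilyDictZ` :58–61).  The β-slot χ `chiFixed29 F N ν ε₁ = fun K _ k => chiFix29OfRecord F N ν ε₁ K k` (`Node00/SmallFieldChi29OfRecord` :304–305) is the indicator of
«every non-tree fluctuation variable `dist1 (V^{(k)}(V̄)(b)⁻¹·V(b)) < ε₁`» (:151–152, :117–118) whose critical configuration `critCfgOfRecord ν K k W = M^k(Uk F N K (k+1) ν.εreg W)`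
(:77–78) reads `ν` ONLY THROUGH `ν.εreg`.  At the Z3 member `θ₁₃ᶜᶜᴹᵂᶻᴮ(j; γ; εbg; ε₀, ε₂₉; B₃, B₃′, a₀, a₁; Efl, logz)` the numerics are `numerics7OfThm1CCM F.L j ε₀ B₃ B₃' a₀ a₁`
with `εreg := a₀` and `ε₀` a SEPARATE field (`Node00/Record13NumericsOfThm1CC1` :145–146; Z3 faces `theta13OfThm1CCMWZB_εreg` ∕ `_ε₀`, `rfl`).  Hence the (1.2) letter `ν.ε₀` is
NOT READ by β of record: it is read by the second-form DOMAIN `domAltOfRecord ν K k = {V | PlaqSmall ν.ε₀ V}` (`Node00/SmallFieldChiOfRecord` :357–358, `Node00/Record7` :59) and by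
the Stage-7 admissibility sign `0 < θ.ν.ε₀` (`Record7` :51–52) only.  §1: `chiβOfRecord₁₃`, `betaOfRecord₁₃`, `gOfRecord₁₃` of the Z3 member at `ε₀` and at `ε₀′` are `rfl`-EQUAL; LETTER CENSUS (`rfl`): β there reads only `γ, εbg, a₀ (= ν.εreg), ε₂₉` —
not `j, ε₀, B₃, B₃′, a₁, Efl, logz`.

CONSEQUENCES TYPED HERE.  §2: an abs β-box of the half-window Z3 member at one label `ε₀` IS the box at every label `ε₀′` (`absBoxZB_iff_ε₀`), so a box proved for SOME `ε₀ > 0` re-packages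
at ANY label `ε₀′` (`exists_absBoxZB_at_of_exists_absBoxZB`).  §3 (text level, at every family `F`): ★ `absBetaBoxGenGridGZEps0At_of_GZAt` — the REGISTERED V22-Z stub 3ᴬ′-G‴-Z text
`K0V22ZDefs.AbsBetaBoxAtThm1WitnessCCMGenGridGZAt F` IMPLIES the strengthened text `K0V22ZDefs.AbsBetaBoxAtThm1WitnessCCMGenGridGZEps0At F` (re-label the ∃-output to `ε₀ := a₀`; the letter
`K0N09Eps0LetterAt F a₀ a₀ : 2·a₀ ≤ a₀·L²` holds since `11 < L`), hence ★ `absBetaBoxGenGridGZEps0At_iff` (the two texts are EQUIVALENT; the converse is g28's door `absBetaBoxGenGridGZAt_of_eps0`),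
the family form `forall_absBetaBoxGenGridGZEps0At_of_forall_GZAt` (dag-n24-c's displayed `h3e : ∀ F, …GZEps0At F` FOLLOWS from the registered `∀ F, …GZAt F`), the WINDOW reader
`exists_window_absBox_of_GZAt` (at every door: some `ε₀` with `2·a₀ ≤ ε₀·L²` AND `ε₀ ≤ a₀` and the box — the plan's (4) literally), and the strongest reader `forall_eps0_absBox_of_GZAt`
(at every door the box holds at EVERY label `ε₀′`).  Consumer side, for the record (nothing to type): L3's closers read stub 3's `ε₀` only through `0 < ε₀` — `clausesH_of_absBoxZB`
(`…K0AllTorusOfStepTokensGuardedZB` :227–247) hands the box's own `ε₀` on unchanged (:245), and the ⁵∕⁷ closers' one `ε₀`-binder is `(hε : 0 < ε₀)` (:77, :132, :148, :164, :182, :200);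
the A2ʷ-ZB rows `hnum`∕`hε0`∕`htI`∕`htMS`∕`hC1`∕`εreg_le` take no `ε₀` hypothesis (their «`B₃·(cR·ε_m) ≤ ν.εreg`» is about the RUNNING thresholds `ε_m = epsOfRecord ν g m` of [III] (2.4), not about
the (1.2) letter).  So the answer to (4) is YES on both sides: the closers tolerate every `ε₀ > 0`, and a producer's box at any `ε₀` is a box at every `ε₀′ ∈ [2a₀∕L², a₀]` for free.

WHAT THIS SAYS FOR LOCATED-K0ε₀ (director-ym №288 (2)(c); display of record = g28's `K0V22ZDefs`, №289 (2)(a)).  Row 3 `2·a₀ ≤ ε₀·L²` costs K0's side NOTHING: the day K0⁷'s REGISTERED stub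
3ᴬ′ `K0Skeleton13SepCoPHV22Z.stub_absBetaBoxAtThm1WitnessCCMGenGridGZ13 : ∀ F, …GZAt F` lands, `∀ F, …GZEps0At F` follows BY §3's DOOR (a re-labelling licensed by §1's `rfl`, NOT an
`le_rfl`-style numerics pin: no value is pinned, every `ε₀′ > 0` serves); no V23 is ever needed; the N24 face may keep displaying `h3e` (today's form) or display the registered `h3` and
derive `h3e` here — the plan's ∕ n24-c's call.  It does NOT touch the B₃ line (№288 (2)(d), n09-w1∕-w2's): whether N09's displayed rows read the SAME `B₃` ∕ the (1.2) letter or the running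
thresholds is theirs to say; §1 only records that β itself reads neither `ε₀` nor (through χ) `B₃`.

HONEST FRAMING (binding).  Typing identities (`rfl`) about the tree's OWN definitions and their ∃-repackagings; NO estimate; nothing of Bałaban's asserted, valued or discharged; NO value
of `ε₀` ∕ `a₀` ∕ `εbg` chosen FOR anybody (§3 exhibits `ε₀ := a₀` as ONE admissible re-labelling and proves every other works too); the abs β-box itself (stub 3ᴬ′-G‴-Z) is PROVED NOWHERE
here — every §2–§3 statement is CONDITIONAL on it or on the registered text; K0⁷ stmt-QuantumFields-20541 V22-Z fe2ecbb43f63b100 «0∕2 (+2′)» UNCHANGED, nothing registered ∕ re-texted;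
FLAG №7 (N09) NOT closed (its located row 3 is shown FREE on K0's side modulo stub 3ᴬ′; rows 1–2 and the B₃ line untouched); K1⁹ 27364 ∕ K3⁸ 27366 OPEN; counts unmoved (typed 28∕28 ·
discharged 8∕28 — the chair's words); R4 = the CONDITIONAL finite-𝕋⁴ rung `BalabanLadder.UV` only — NOT continuum ∕ ℝ⁴ ∕ OS; the Yang–Mills mass gap (Clay) is NOT proved by any of this.
Standard axioms only.
-/

noncomputable section

open scoped Matrix.Norms.L2Operator

namespace Summit.QuantumFields.YangMills.Theorems.K0ZBWitnessBetaEps0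

open Literature.MathematicalPhysics.QuantumFieldTheory.Balaban1983to89
open Literature.MathematicalPhysics.QuantumFieldTheory.Balaban1983to89.Node00
open Literature.MathematicalPhysics.QuantumFieldTheory.Balaban1983to89.T4Continuum
open Literature.MathematicalPhysics.QuantumFieldTheory.Balaban1983to89.FlowStep
open Summit.QuantumFields.YangMills.Theorems.K0V22ZDefs (AbsBetaBoxAtThm1WitnessCCMGenGridGZAt AbsBetaBoxAtThm1WitnessCCMGenGridGZEps0At K0N09Eps0LetterAt
  absBetaBoxGenGridGZAt_of_eps0)

/-! ## §1  ε₀-BLINDNESS AT THE Z3 MEMBER — three `rfl`s and the letter census -/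

section Blind

variable (F : T4Family) (N : ℕ) [NeZero N] (j : ℕ) (γ εbg ε₀ ε₀' ε₂₉ B₃ B₃' a₀ a₁ : ℝ) (Efl logz : B12.RunParams → ℕ → ℝ)

/-- **★ THE β-SLOT χ OF THE Z3 MEMBER IS `ε₀`-BLIND (`rfl`)**: the (2.9) species `χ^{(2.9)}_k` reads the numerics only through the cut-off radius `ν.εreg = a₀` (its critical configuration
`M^k(U_{k+1}(a₀; W))`) and the threshold `ε₂₉`; the (1.2) letter `ν.ε₀` is not read. [cite: Balaban1987RG1, (2.9) p.266, (1.2) p.260, (0.19) p.255; Balaban1985Variational, Thm 1 (8) p.279 (bookkeeping)] -/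
theorem chiβOfRecord₁₃_theta13OfThm1CCMWZB_ε₀ :
    chiβOfRecord₁₃ F N (theta13OfThm1CCMWZB F N j γ εbg ε₀ ε₂₉ B₃ B₃' a₀ a₁ Efl logz) =
      chiβOfRecord₁₃ F N (theta13OfThm1CCMWZB F N j γ εbg ε₀' ε₂₉ B₃ B₃' a₀ a₁ Efl logz) := rfl

/-- **★★ β OF RECORD AT THE Z3 MEMBER IS `ε₀`-BLIND (`rfl`)**: [I] (1.20)–(1.22) on the merged term (1.6) read `θ` through `εbg` (here the letter `εbg`), the fixed chart of 𝔰𝔲(N), the zero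
base histories, the window `γ`, the transport of record and the `ε₀`-blind χ above — so the (1.2) small-field letter of the witness does not enter. [cite: Balaban1987RG1, (1.20)–(1.22) p.264, (1.6) p.261, (0.21) p.256, (2.9) p.266, (1.2) p.260 (bookkeeping)] -/
theorem betaOfRecord₁₃_theta13OfThm1CCMWZB_ε₀ :
    betaOfRecord₁₃ F N (theta13OfThm1CCMWZB F N j γ εbg ε₀ ε₂₉ B₃ B₃' a₀ a₁ Efl logz) =
      betaOfRecord₁₃ F N (theta13OfThm1CCMWZB F N j γ εbg ε₀' ε₂₉ B₃ B₃' a₀ a₁ Efl logz) := rfl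

/-- … hence so are the GENERATED HISTORIES `g_k = genSeq β g₀` of every run (`rfl`). [cite: Balaban1987RG1, (0.17)–(0.20) pp.255–256 (bookkeeping)] -/
theorem gOfRecord₁₃_theta13OfThm1CCMWZB_ε₀ :
    gOfRecord₁₃ F N (theta13OfThm1CCMWZB F N j γ εbg ε₀ ε₂₉ B₃ B₃' a₀ a₁ Efl logz) =
      gOfRecord₁₃ F N (theta13OfThm1CCMWZB F N j γ εbg ε₀' ε₂₉ B₃ B₃' a₀ a₁ Efl logz) := rfl

/-- **LETTER CENSUS (`rfl`)**: of the Z3 witness's letters, β of record reads ONLY the window `γ`, the background radius `εbg`, the cut-off radius `a₀` (through `ν.εreg`) and the (2.9)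
threshold `ε₂₉` — NOT the cube letter `j`, the (1.2) letter `ε₀`, the (8)∕(9) constants `B₃, B₃′, a₁`, nor `Efl, logz` (g27 `…_tokens`).  So the abs β-box of stub 3ᴬ′-G‴-Z at a door is a
sentence about `(F; ½, a₀, a₀, ε₂₉)` alone; the door's other letters bear on it only through the (8)-sentence and the (9)-token they key. [cite: Balaban1987RG1, (1.20)–(1.22) p.264, (1.6) p.261, (0.21) p.256, (2.9) p.266; Balaban1985Variational, Thm 1 (8),(9) p.279 (bookkeeping)] -/
theorem betaOfRecord₁₃_theta13OfThm1CCMWZB_letterCensus (j' : ℕ) (b₃ b₃' a₁' : ℝ) (Efl' logz' : B12.RunParams → ℕ → ℝ) :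
    betaOfRecord₁₃ F N (theta13OfThm1CCMWZB F N j γ εbg ε₀ ε₂₉ B₃ B₃' a₀ a₁ Efl logz) =
      betaOfRecord₁₃ F N (theta13OfThm1CCMWZB F N j' γ εbg ε₀' ε₂₉ b₃ b₃' a₀ a₁' Efl' logz') := rfl

end Blind

/-! ## §2  One abs β-box of the half-window Z3 member at a label `ε₀` IS the box at every label `ε₀′` -/

section Box

variable (F : T4Family) (j : ℕ) (εbg ε₀ ε₀' ε₂₉ B₃ B₃' a₀ a₁ γ₀ β' : ℝ) (Efl logz : B12.RunParams → ℕ → ℝ)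

/-- **The abs β-box of `θ₁₃ᶜᶜᴹᵂᶻᴮ(j; ½; εbg; ε₀, ε₂₉)` and of `θ₁₃ᶜᶜᴹᵂᶻᴮ(j; ½; εbg; ε₀′, ε₂₉)` are THE SAME PROPOSITION** (one `rw` by §1). [cite: Balaban1987RG1, Thm 1 p.259, (1.20)–(1.22) p.264, (1.2) p.260 (bookkeeping)] -/
theorem absBoxZB_iff_ε₀ :
    (BetaLowerH (-β') γ₀ (betaOfRecord₁₃ F 2 (theta13OfThm1CCMWZB F 2 j (1 / 2) εbg ε₀ ε₂₉ B₃ B₃' a₀ a₁ Efl logz)) ∧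
      BetaUpperH β' γ₀ (betaOfRecord₁₃ F 2 (theta13OfThm1CCMWZB F 2 j (1 / 2) εbg ε₀ ε₂₉ B₃ B₃' a₀ a₁ Efl logz))) ↔
    (BetaLowerH (-β') γ₀ (betaOfRecord₁₃ F 2 (theta13OfThm1CCMWZB F 2 j (1 / 2) εbg ε₀' ε₂₉ B₃ B₃' a₀ a₁ Efl logz)) ∧
      BetaUpperH β' γ₀ (betaOfRecord₁₃ F 2 (theta13OfThm1CCMWZB F 2 j (1 / 2) εbg ε₀' ε₂₉ B₃ B₃' a₀ a₁ Efl logz))) := by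
  rw [betaOfRecord₁₃_theta13OfThm1CCMWZB_ε₀ F 2 j (1 / 2) εbg ε₀ ε₀' ε₂₉ B₃ B₃' a₀ a₁ Efl logz]

variable {F j εbg ε₂₉ B₃ B₃' a₀ a₁ Efl logz} in
/-- **A box proved for SOME label `ε₀ > 0` IS a box at ANY label `ε₀′`** (with the same `γ₀, ε₂₉, β′`; the form L3's closers and the N24 engine consume — their only `ε₀`-binder is
`0 < ε₀`, which the consumer supplies for its own `ε₀′`). [cite: Balaban1987RG1, Thm 1 p.259, (1.2) p.260, §1 p.264 (bookkeeping)] -/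
theorem exists_absBoxZB_at_of_exists_absBoxZB
    (h : ∃ γ₀ ε₀ ε₂₉ β' : ℝ, 0 < γ₀ ∧ 0 < ε₀ ∧ 0 < ε₂₉ ∧
        BetaLowerH (-β') γ₀ (betaOfRecord₁₃ F 2 (theta13OfThm1CCMWZB F 2 j (1 / 2) εbg ε₀ ε₂₉ B₃ B₃' a₀ a₁ Efl logz)) ∧
        BetaUpperH β' γ₀ (betaOfRecord₁₃ F 2 (theta13OfThm1CCMWZB F 2 j (1 / 2) εbg ε₀ ε₂₉ B₃ B₃' a₀ a₁ Efl logz))) :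
    ∃ γ₀ ε₂₉ β' : ℝ, 0 < γ₀ ∧ 0 < ε₂₉ ∧
        BetaLowerH (-β') γ₀ (betaOfRecord₁₃ F 2 (theta13OfThm1CCMWZB F 2 j (1 / 2) εbg ε₀' ε₂₉ B₃ B₃' a₀ a₁ Efl logz)) ∧
        BetaUpperH β' γ₀ (betaOfRecord₁₃ F 2 (theta13OfThm1CCMWZB F 2 j (1 / 2) εbg ε₀' ε₂₉ B₃ B₃' a₀ a₁ Efl logz)) := by
  obtain ⟨γ₀, ε₀, ε₂₉, β', hγ₀, -, hε₂₉, hbox⟩ := h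
  exact ⟨γ₀, ε₂₉, β', hγ₀, hε₂₉, (absBoxZB_iff_ε₀ F j εbg ε₀ ε₀' ε₂₉ B₃ B₃' a₀ a₁ γ₀ β' Efl logz).1 hbox⟩

end Box

/-! ## §3  ★ The text-level doors at every family: REGISTERED 3ᴬ′-G‴-Z ⟺ the strengthened text of LOCATED-K0ε₀; the window reader answering plan g92 (4) -/

section Doors

/-- The interface letter at the top of the window: `K0N09Eps0LetterAt F a₀ a₀`, i.e. `2·a₀ ≤ a₀·L²`, for every `0 ≤ a₀` (since `11 < L`). [cite: Balaban1987RG1, (0.1) p.251, (1.2) p.260 (bookkeeping)] -/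
theorem k0N09Eps0LetterAt_self (F : T4Family) {a₀ : ℝ} (ha₀ : 0 ≤ a₀) : K0N09Eps0LetterAt F a₀ a₀ := by
  have hL : (12 : ℝ) ≤ (F.L : ℝ) := by exact_mod_cast F.hL11
  have hL2 : (2 : ℝ) ≤ (F.L : ℝ) ^ 2 := by nlinarith
  show 2 * a₀ ≤ a₀ * (F.L : ℝ) ^ 2
  nlinarith

/-- More generally the letter holds at every label `ε₀′ ≥ 2·a₀∕L²`; in particular on the whole window `[2a₀∕L², a₀]` (trivial bookkeeping, displayed for consumers). [cite: Balaban1987RG1, (1.2) p.260 (bookkeeping)] -/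
theorem k0N09Eps0LetterAt_of_le (F : T4Family) {a₀ ε₀' : ℝ} (h : 2 * a₀ / (F.L : ℝ) ^ 2 ≤ ε₀') : K0N09Eps0LetterAt F a₀ ε₀' := by
  have hL : (12 : ℝ) ≤ (F.L : ℝ) := by exact_mod_cast F.hL11
  have hL2 : (0 : ℝ) < (F.L : ℝ) ^ 2 := by positivity
  show 2 * a₀ ≤ ε₀' * (F.L : ℝ) ^ 2
  rwa [div_le_iff₀ hL2] at h

/-- **★ THE REGISTERED V22-Z STUB 3ᴬ′-G‴-Z TEXT IMPLIES THE STRENGTHENED TEXT OF LOCATED-K0ε₀** at every family: re-label the ∃-output to `ε₀ := a₀` (§2) and read the letter off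
`k0N09Eps0LetterAt_self`.  With g28's converse door the two texts are equivalent (next theorem). CONDITIONAL on the registered text; nothing asserted. [cite: Balaban1987RG1, Thm 1 p.259, (1.2) p.260, (1.20)–(1.22) p.264; Balaban1985Variational, Thm 1 (8),(9) p.279; Balaban1988Convergent, (2.1) p.254, (2.5) p.255 (bookkeeping)] -/
theorem absBetaBoxGenGridGZEps0At_of_GZAt (F : T4Family) (h : AbsBetaBoxAtThm1WitnessCCMGenGridGZAt F) : AbsBetaBoxAtThm1WitnessCCMGenGridGZEps0At F :=
  fun j c c₀ c₁ B₃ B₃' a₀ a₁ hc hc₀ hc₁ hB₃ hB₃' ha₀ ha₁ h15 h9 => by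
    obtain ⟨γ₀, ε₂₉, β', hγ₀, hε₂₉, hlow, hup⟩ :=
      exists_absBoxZB_at_of_exists_absBoxZB (ε₀' := a₀) (h j c c₀ c₁ B₃ B₃' a₀ a₁ hc hc₀ hc₁ hB₃ hB₃' ha₀ ha₁ h15 h9)
    exact ⟨γ₀, a₀, ε₂₉, β', hγ₀, ha₀, hε₂₉, k0N09Eps0LetterAt_self F ha₀.le, hlow, hup⟩

/-- **★ THE TWO TEXTS ARE EQUIVALENT at every family**: strengthened (LOCATED-K0ε₀) ⟺ REGISTERED V22-Z 3ᴬ′-G‴-Z (⟹ is g28's `K0V22ZDefs.absBetaBoxGenGridGZAt_of_eps0`). [cite: Balaban1987RG1, Thm 1 p.259, (1.2) p.260, §1 p.264 (bookkeeping)] -/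
theorem absBetaBoxGenGridGZEps0At_iff (F : T4Family) : AbsBetaBoxAtThm1WitnessCCMGenGridGZEps0At F ↔ AbsBetaBoxAtThm1WitnessCCMGenGridGZAt F :=
  ⟨absBetaBoxGenGridGZAt_of_eps0 F, absBetaBoxGenGridGZEps0At_of_GZAt F⟩

/-- **Family form**: dag-n24-c's displayed `h3e : ∀ F, …GridGZEps0At F` FOLLOWS from the REGISTERED stub 3ᴬ′ `∀ F, …GridGZAt F` (the day it lands, row 3 of LOCATED-N09NUM is served
by K0⁷'s own stub through this door). CONDITIONAL. [cite: Balaban1987RG1, Thm 1 p.259, (1.2) p.260 (bookkeeping)] -/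
theorem forall_absBetaBoxGenGridGZEps0At_of_forall_GZAt (h3 : ∀ F : T4Family, AbsBetaBoxAtThm1WitnessCCMGenGridGZAt F) :
    ∀ F : T4Family, AbsBetaBoxAtThm1WitnessCCMGenGridGZEps0At F :=
  fun F => absBetaBoxGenGridGZEps0At_of_GZAt F (h3 F)

/-- **★ THE WINDOW READER — plan g92's (4) literally**: from the REGISTERED text, at every door `(j, c, c₀, c₁; B₃, B₃′, a₀, a₁)` carrying the guards, the (8)-sentence and the
(9)-token, there is a label `ε₀` IN THE WINDOW `2·a₀∕L² ≤ ε₀ ≤ a₀` (namely `ε₀ = a₀`) with `0 < ε₀` and the abs β-box of the Z3 print-regime member at that label. CONDITIONAL.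
[cite: Balaban1987RG1, Thm 1 p.259, (1.2) p.260, (0.21) p.256, (1.20)–(1.22) p.264; Balaban1985Variational, Thm 1 (8),(9) p.279 (bookkeeping)] -/
theorem exists_window_absBox_of_GZAt (F : T4Family) (h : AbsBetaBoxAtThm1WitnessCCMGenGridGZAt F) (j c c₀ c₁ : ℕ) (B₃ B₃' a₀ a₁ : ℝ)
    (hc : c ≤ F.L ^ j) (hc₀ : c₀ ≤ j + 1) (hc₁ : c₁ ≤ j) (hB₃ : 2 * (F.L : ℝ) ^ 2 ≤ B₃) (hB₃' : 0 < B₃') (ha₀ : 0 < a₀) (ha₁ : 0 < a₁)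
    (h15 : VariationalThm1RegSepCoP7MG F 2
      (fun ν M g K k _s => c ≤ ν.M₁ ∧ k + c₀ ≤ F.m + K ∧ F.L ^ c₁ ∣ M ∧
        ∀ i, 1 ≤ i → i ≤ k → dCubeSide (F.P K).L M (RkOfRecord (F.P K).L ν.r (g i)) i ∣ (F.P K).sitesPerDir 0) B₃ a₀ a₁)
    (h9 : Gauge9RegSepTopStepG F 2 (fun ν K Ω => suppDomOfRecord F ν K Ω) (F.L ^ j)
      (fun ν M g K k _s => c ≤ ν.M₁ ∧ k + c₀ ≤ F.m + K ∧ F.L ^ c₁ ∣ M ∧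
        ∀ i, 1 ≤ i → i ≤ k → dCubeSide (F.P K).L M (RkOfRecord (F.P K).L ν.r (g i)) i ∣ (F.P K).sitesPerDir 0) B₃ B₃' a₀ a₁) :
    ∃ γ₀ ε₀ ε₂₉ β' : ℝ, 0 < γ₀ ∧ 0 < ε₀ ∧ 0 < ε₂₉ ∧ 2 * a₀ ≤ ε₀ * (F.L : ℝ) ^ 2 ∧ ε₀ ≤ a₀ ∧
      BetaLowerH (-β') γ₀ (betaOfRecord₁₃ F 2 (theta13OfThm1CCMWZB F 2 j (1 / 2) a₀ ε₀ ε₂₉ B₃ B₃' a₀ a₁ (fun _ _ => 0) (fun _ _ => 0))) ∧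
      BetaUpperH β' γ₀ (betaOfRecord₁₃ F 2 (theta13OfThm1CCMWZB F 2 j (1 / 2) a₀ ε₀ ε₂₉ B₃ B₃' a₀ a₁ (fun _ _ => 0) (fun _ _ => 0))) := by
  obtain ⟨γ₀, ε₂₉, β', hγ₀, hε₂₉, hlow, hup⟩ :=
    exists_absBoxZB_at_of_exists_absBoxZB (ε₀' := a₀) (h j c c₀ c₁ B₃ B₃' a₀ a₁ hc hc₀ hc₁ hB₃ hB₃' ha₀ ha₁ h15 h9)
  exact ⟨γ₀, a₀, ε₂₉, β', hγ₀, ha₀, hε₂₉, k0N09Eps0LetterAt_self F ha₀.le, le_rfl, hlow, hup⟩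

/-- **★ THE STRONGEST READER**: from the REGISTERED text, at every door the abs β-box of the Z3 print-regime member holds AT EVERY LABEL `ε₀′` (any real; with the box's own `γ₀, ε₂₉, β′`) —
a consumer needing any particular relation between `ε₀′` and `(a₀, L, B₃, …)` just picks its `ε₀′` (and supplies `0 < ε₀′` itself where a closer asks). CONDITIONAL. [cite: Balaban1987RG1, Thm 1 p.259, (1.2) p.260, (1.20)–(1.22) p.264; Balaban1985Variational, Thm 1 (8),(9) p.279 (bookkeeping)] -/
theorem forall_eps0_absBox_of_GZAt (F : T4Family) (h : AbsBetaBoxAtThm1WitnessCCMGenGridGZAt F) (j c c₀ c₁ : ℕ) (B₃ B₃' a₀ a₁ : ℝ)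
    (hc : c ≤ F.L ^ j) (hc₀ : c₀ ≤ j + 1) (hc₁ : c₁ ≤ j) (hB₃ : 2 * (F.L : ℝ) ^ 2 ≤ B₃) (hB₃' : 0 < B₃') (ha₀ : 0 < a₀) (ha₁ : 0 < a₁)
    (h15 : VariationalThm1RegSepCoP7MG F 2
      (fun ν M g K k _s => c ≤ ν.M₁ ∧ k + c₀ ≤ F.m + K ∧ F.L ^ c₁ ∣ M ∧
        ∀ i, 1 ≤ i → i ≤ k → dCubeSide (F.P K).L M (RkOfRecord (F.P K).L ν.r (g i)) i ∣ (F.P K).sitesPerDir 0) B₃ a₀ a₁)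
    (h9 : Gauge9RegSepTopStepG F 2 (fun ν K Ω => suppDomOfRecord F ν K Ω) (F.L ^ j)
      (fun ν M g K k _s => c ≤ ν.M₁ ∧ k + c₀ ≤ F.m + K ∧ F.L ^ c₁ ∣ M ∧
        ∀ i, 1 ≤ i → i ≤ k → dCubeSide (F.P K).L M (RkOfRecord (F.P K).L ν.r (g i)) i ∣ (F.P K).sitesPerDir 0) B₃ B₃' a₀ a₁)
    (ε₀' : ℝ) :
    ∃ γ₀ ε₂₉ β' : ℝ, 0 < γ₀ ∧ 0 < ε₂₉ ∧
      BetaLowerH (-β') γ₀ (betaOfRecord₁₃ F 2 (theta13OfThm1CCMWZB F 2 j (1 / 2) a₀ ε₀' ε₂₉ B₃ B₃' a₀ a₁ (fun _ _ => 0) (fun _ _ => 0))) ∧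
      BetaUpperH β' γ₀ (betaOfRecord₁₃ F 2 (theta13OfThm1CCMWZB F 2 j (1 / 2) a₀ ε₀' ε₂₉ B₃ B₃' a₀ a₁ (fun _ _ => 0) (fun _ _ => 0))) := by
  exact exists_absBoxZB_at_of_exists_absBoxZB (ε₀' := ε₀') (h j c c₀ c₁ B₃ B₃' a₀ a₁ hc hc₀ hc₁ hB₃ hB₃' ha₀ ha₁ h15 h9)

end Doors

end Summit.QuantumFields.YangMills.Theorems.K0ZBWitnessBetaEps0

end
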